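import Summits.Ventures.DiscreteObjects.PP12.OrderThirteenRelabel

/-!
# PP(12), order-13 cell: multiplier invariance of the lift normal form (kernel; second brick of the symmetry reduction)
Framing: lottery ticket; floor = certified bounds/negative ranges.

Cell pub-namedobj (venture DiscreteObjects), target (M), designs gen 18; continues `OrderThirteenRelabel`. Besides relabelling the orbits, valid lift data
can be rescaled by a unit of `Z_p` (replacing the generator `σ` of the cyclic group by a power): `LiftData.scale D b` has `mem s t x := D.mem s t (b * x)`,
i.e. its sets are `a • E_{s,t}` for `a * b = 1`, and **`LiftData.valid_scale`**: validity is preserved (differences scale by the unit). With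
`valid_relabel_iff`: **`noLiftData13_of_normalized'`** — it suffices to refute valid data in any normal form reachable by relabelling AND rescaling
(symmetry group `S₁₁ × S₁₁ × Z₁₃ˣ`, the reduction used by the engines `omgen.c` / `liftplus.c --norm` outside the kernel). Pure logic; nothing asserts any
census statement. No `sorry`, no new axioms.
-/

namespace Summit.Ventures.DiscreteObjects.PP12

namespace LiftData

variable {N p : ℕ}

/-- rescale the residues: the new sets are `a • E_{s,t}`, encoded through the inverse `b` of `a` -/
def scale (D : LiftData N p) (b : Fin p) : LiftData N p :=
  ⟨fun s t x => D.mem s t (b * x)⟩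

/-- the membership table of rescaled data -/
@[simp] theorem scale_mem (D : LiftData N p) (b : Fin p) (s t : Fin N) (x : Fin p) : (D.scale b).mem s t x = D.mem s t (b * x) := rfl

variable [NeZero p]

/-- a unit does not kill non-zero residues -/
theorem mul_ne_zero_of_unit {a b : Fin p} (hab : a * b = 1) {x : Fin p} (hx : x ≠ 0) : b * x ≠ 0 := by
  intro h
  apply hx
  have : a * (b * x) = 0 := by rw [h, mul_zero]
  rwa [← mul_assoc, hab, one_mul] at this

/-- cancelling the unit -/
theorem unit_cancel {a b : Fin p} (hab : a * b = 1) (y : Fin p) : b * (a * y) = y := by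
  rw [← mul_assoc, mul_comm b a, hab, one_mul]

/-- (M·U) is preserved by rescaling -/
theorem rowPartition_scale (D : LiftData N p) {a b : Fin p} (hab : a * b = 1) {s : Fin N} (h : D.RowPartition s) : (D.scale b).RowPartition s := by
  obtain ⟨h0, h1⟩ := h
  refine ⟨fun t => by simp [h0 t], fun x hx => ?_⟩
  obtain ⟨t, ht, huniq⟩ := h1 (b * x) (mul_ne_zero_of_unit hab hx)
  exact ⟨t, by simpa using ht, fun t' ht' => huniq t' (by simpa using ht')⟩

/-- (U·U) is preserved by rescaling -/
theorem internal_scale (D : LiftData N p) {a b : Fin p} (hab : a * b = 1) {s : Fin N} (h : D.Internal s) : (D.scale b).Internal s := by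
  intro δ hδ
  obtain ⟨t, y, h1, h2, huniq⟩ := h (b * δ) (mul_ne_zero_of_unit hab hδ)
  refine ⟨t, a * y, ?_, ?_, fun t' x' h1' h2' => ?_⟩
  · simpa [unit_cancel hab] using h1
  · simp only [scale_mem, mul_sub, unit_cancel hab]; exact h2
  · simp only [scale_mem, mul_sub] at h1' h2'
    obtain ⟨e1, e2⟩ := huniq t' (b * x') h1' h2'
    refine ⟨e1, ?_⟩
    rw [← e2, ← mul_assoc, hab, one_mul]

/-- (U·U′) is preserved by rescaling -/
theorem cross_scale (D : LiftData N p) {a b : Fin p} (hab : a * b = 1) {s s' : Fin N} (h : D.Cross s s') : (D.scale b).Cross s s' := by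
  obtain ⟨hd, h⟩ := h
  refine ⟨fun t x => by simpa using hd t (b * x), fun δ hδ => ?_⟩
  obtain ⟨t, y, h1, h2, huniq⟩ := h (b * δ) (mul_ne_zero_of_unit hab hδ)
  refine ⟨t, a * y, ?_, ?_, fun t' x' h1' h2' => ?_⟩
  · simpa [unit_cancel hab] using h1
  · simp only [scale_mem, mul_sub, unit_cancel hab]; exact h2
  · simp only [scale_mem, mul_sub] at h1' h2'
    obtain ⟨e1, e2⟩ := huniq t' (b * x') h1' h2'
    refine ⟨e1, ?_⟩
    rw [← e2, ← mul_assoc, hab, one_mul]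

/-- **multiplier invariance of the lift normal form** -/
theorem valid_scale (D : LiftData N p) {a b : Fin p} (hab : a * b = 1) (h : D.Valid) : (D.scale b).Valid :=
  ⟨fun s => ⟨rowPartition_scale D hab (h.1 s).1, internal_scale D hab (h.1 s).2⟩, fun s s' hne => cross_scale D hab (h.2 s s' hne)⟩

end LiftData

/-- **Symmetry reduction for a certificate of `NoLiftData13`, with multipliers:** if every valid lift data has some relabelled and rescaled copy in a
normal form `NF`, it suffices to refute the valid data in normal form. -/
theorem noLiftData13_of_normalized' (NF : LiftData 11 13 → Prop)
    (hcover : ∀ D : LiftData 11 13, D.Valid → ∃ (ρ τ : Equiv.Perm (Fin 11)) (a b : Fin 13), a * b = 1 ∧ NF ((D.relabel ρ τ).scale b))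
    (hNF : ∀ D : LiftData 11 13, NF D → ¬ D.Valid) : NoLiftData13 := by
  intro D hD
  obtain ⟨ρ, τ, a, b, hab, hnf⟩ := hcover D hD
  exact hNF _ hnf (LiftData.valid_scale _ hab ((LiftData.valid_relabel_iff D ρ τ).2 hD))

end Summit.Ventures.DiscreteObjects.PP12
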